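import Literature.NumberTheory.GaloisRepresentations.LocalWeilDatumDegree
import Literature.NumberTheory.GaloisRepresentations.LocalReciprocityOfWeilDatum
import HarnessLib

/-!
# The Weil datum of a non-archimedean local field, VI: assembly, and finite-level reciprocity from the class field axiom

This file assembles Neukirch's abstract class field theory datum of a non-archimedean local field
`F` (*Algebraic Number Theory*, Ch. V §1: "`G = G(k̄|k)`, `A = k̄*`, `A_K = K*`, `d`, `v_K`") in the
Weil-group form of `AbstractClassFieldTheory.lean`:

* `LocalWeilDatum.localWeilDatum F : WeilDatum (WeilGroup F) (F^sep)ˣ` — degree `WeilGroup.deg`,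
  fields the Weil subgroups `W_F ∩ G_K` of the finite separable `K ⊆ F̄`, valuation `ord_F`; all of
  Neukirch's axioms ((4.6) and the formal properties of §4) are **proved**: the lattice/finiteness/
  smoothness axioms (`LocalWeilDatum.lean`), the unramified levels `deg⁻¹(nℤ) = W_F ∩ G_{F_n}`
  (`LocalWeilDatumUnramified.lean`), and the henselian valuation `v(N_{K|F} Kˣ) = f_K ℤ`
  (`LocalWeilDatumValuation.lean`, `LocalWeilDatumDegree.lean`);
* `LocalWeilDatum.isLocalDatum_localWeilDatum`: it is a local datum in the sense of
  `LocalReciprocityOfWeilDatum.lean`;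
* `LocalWeilDatum.exists_isReciprocitySystem_of_isClassFieldTheory`: **the finite-level local
  reciprocity fact `exists_isReciprocitySystem F` follows from the class field axiom**
  `(localWeilDatum F).IsClassFieldTheory` (Neukirch IV (6.1), for local fields Thm. V (1.1):
  `#H⁰(G(L|K), L*) = [L:K]`, `H⁻¹ = 1` for cyclic `L|K`) — via the general reciprocity law
  (`AbstractReciprocityLaw*.lean`) and the glue of `LocalReciprocityOfWeilDatum.lean`.

## References

* J. Neukirch, *Algebraic Number Theory*, Grundlehren 322, Springer 1999, Ch. IV §4 ((4.6)),
  §6 ((6.1), (6.3)); Ch. V §1 (pp. 317–318, Thm. (1.1), Thm. (1.3)). [NeukirchANT1999]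
-/

noncomputable section

open Field IsNonarchimedeanLocalField ValuativeRel
open scoped Pointwise Valued

namespace Literature.NumberTheory.GaloisRepresentations

namespace LocalWeilDatum

open AbstractCFT AbstractCFT.WeilDatum GaloisRepresentations.IsNonarchimedeanLocalField

section Local

variable (F : Type*) [Field F] [ValuativeRel F] [TopologicalSpace F] [IsNonarchimedeanLocalField F]

/-! ### The valuation of the datum on `Fˣ` -/

/-- `vSep a = ord x` when `a` is the image of `x ∈ F`. [folklore] -/
theorem vSep_eq_ord {a : SepUnits F} {x : F}
    (h : algebraMap F (AlgebraicClosure F) x = ((a : SepClosure F) : AlgebraicClosure F)) :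
    vSep F a = ord F x := by
  classical
  have hex : ∃ y : F, algebraMap F (AlgebraicClosure F) y = ((a : SepClosure F) : AlgebraicClosure F) := ⟨x, h⟩
  unfold vSep
  rw [dif_pos hex]
  congr 1
  exact (algebraMap F (AlgebraicClosure F)).injective (hex.choose_spec.trans h.symm)

/-- `vSep (unitOf x) = ord x`: the valuation of the datum is `ord_F` on `Fˣ`. [cite: NeukirchANT1999, Ch. V §1] -/
theorem vSep_unitOf (x : Fˣ) : vSep F (unitOf F x) = ord F x :=
  vSep_eq_ord F (coe_unitOf F x).symm

/-- The unit of `(F^sep)ˣ` attached to a non-zero element of `F^sep` (given inside `F̄`). [folklore] -/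
def sepUnitOf {y : AlgebraicClosure F} (hy : y ∈ sepClosure F) (hy0 : y ≠ 0) : SepUnits F :=
  Units.mk0 ⟨y, hy⟩ (fun h => hy0 (congrArg Subtype.val h))

omit [ValuativeRel F] [TopologicalSpace F] [IsNonarchimedeanLocalField F] in
/-- `sepUnitOf y` is `y` in `F̄`. [folklore] -/
@[simp]
theorem coe_sepUnitOf {y : AlgebraicClosure F} (hy : y ∈ sepClosure F) (hy0 : y ≠ 0) :
    (((sepUnitOf F hy hy0 : SepUnits F) : SepClosure F) : AlgebraicClosure F) = y :=
  rfl

/-! ### The datum -/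

/-- **The Weil datum of the non-archimedean local field `F`** (Neukirch Ch. V §1 in the Weil-group
form of `AbstractClassFieldTheory.WeilDatum`): `W = W_F` acting on `A = (F^sep)ˣ`, `deg` the degree of
the Weil group, fields the Weil subgroups `W_F ∩ G_K` of the finite separable `K ⊆ F̄`, `v = ord_F`
on `Fˣ`.  All axioms are theorems: unramified levels (`isFieldSubgroup_degMultiples`) and the
henselian valuation `v(N_{K|F} Kˣ) = f_K ℤ` (`inertiaDeg_dvd_ord_norm`,
`exists_ord_norm_eq_inertiaDeg`, `inertiaDeg_fieldSubgroup_eq`, norm dictionary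
`norm_fieldSubgroup_top_eq_algebraMap`).
[cite: NeukirchANT1999, Ch. V §1 (pp. 317–318); Ch. IV §4 (4.6)] -/
def localWeilDatum : WeilDatum (WeilGroup F) (SepUnits F) where
  deg := degHom F
  exists_degZ_eq_one := exists_degZ_eq_one F
  IsField := IsFieldSubgroup F
  isField_top := isFieldSubgroup_top F
  isField_inf := fun hU hV => isFieldSubgroup_inf F hU hV
  isField_of_le := fun hU hUV => isFieldSubgroup_of_le F hU hUV
  isField_conjSub := fun hU σ => isFieldSubgroup_conjSub F hU σ
  finiteIndex_of_isField := fun hU => finiteIndex_of_isFieldSubgroup F hU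
  isField_stabilizer := isFieldSubgroup_stabilizer F
  isField_degMultiples := isFieldSubgroup_degMultiples F
  v := vSep F
  v_mul := fun a ha b hb => by
    obtain ⟨x, rfl⟩ := exists_unitOf_eq_of_mem_fixedBy_top F ha
    obtain ⟨y, rfl⟩ := exists_unitOf_eq_of_mem_fixedBy_top F hb
    rw [show unitOf F x * unitOf F y = unitOf F (x * y) by simp [unitOf], vSep_unitOf, vSep_unitOf,
      vSep_unitOf, Units.val_mul, ord_mul F x.ne_zero y.ne_zero]
  dvd_v_norm := fun {U} hU a ha => by
    obtain ⟨K, hK, hKs, rfl⟩ := hU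
    haveI := hK
    have haK := mem_of_mem_fixedBy_fieldSubgroup F hKs ha
    have ha0 : (⟨_, haK⟩ : K) ≠ 0 := fun h =>
      (Units.ne_zero a) (Subtype.ext (congrArg Subtype.val h :))
    rw [vSep_eq_ord F (norm_fieldSubgroup_top_eq_algebraMap F K hKs haK).symm,
      inertiaDeg_fieldSubgroup_eq F K hKs]
    exact inertiaDeg_dvd_ord_norm F K hKs _ ha0
  exists_v_norm_eq := fun {U} hU => by
    obtain ⟨K, hK, hKs, rfl⟩ := hU
    haveI := hK
    obtain ⟨c, hc0, hc⟩ := exists_ord_norm_eq_inertiaDeg F K hKs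
    have hcs : ((c : K) : AlgebraicClosure F) ∈ sepClosure F := hKs (c : K).2
    have hc0' : ((c : K) : AlgebraicClosure F) ≠ 0 := fun h => hc0 (Subtype.ext (Subtype.ext h))
    refine ⟨sepUnitOf F hcs hc0', mem_fixedBy_fieldSubgroup_of_mem F (c : K).2, ?_⟩
    have hmem : (((sepUnitOf F hcs hc0' : SepUnits F) : SepClosure F) : AlgebraicClosure F) ∈ K := (c : K).2
    rw [vSep_eq_ord F (norm_fieldSubgroup_top_eq_algebraMap F K hKs hmem).symm,
      inertiaDeg_fieldSubgroup_eq F K hKs, ← hc]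
    exact congrArg (fun z : K => ord F (Algebra.norm F z)) (Subtype.ext rfl)

/-- Unfolding: the fields of the local datum are the Weil subgroups of the finite separable `K ⊆ F̄`.
[folklore] -/
theorem isField_localWeilDatum_iff (U : Subgroup (WeilGroup F)) :
    (localWeilDatum F).IsField U ↔ IsFieldSubgroup F U :=
  Iff.rfl

/-- Unfolding: the degree of the local datum is `WeilGroup.deg`. [folklore] -/
theorem degZ_localWeilDatum (w : WeilGroup F) : (localWeilDatum F).degZ w = WeilGroup.deg w :=
  degZ_degHom F w

/-- Unfolding: the valuation of the local datum is `ord_F` on `Fˣ`. [folklore] -/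
theorem v_localWeilDatum_unitOf (x : Fˣ) : (localWeilDatum F).v (unitOf F x) = ord F x :=
  vSep_unitOf F x

/-- **The Weil datum of `F` is a local datum** (its fields, degree and valuation are the local
ones). [cite: NeukirchANT1999, Ch. V §1] -/
theorem isLocalDatum_localWeilDatum : IsLocalDatum F (localWeilDatum F) where
  isField_iff := isField_localWeilDatum_iff F
  degZ_eq := degZ_localWeilDatum F
  v_unitOf := v_localWeilDatum_unitOf F

/-! ### Finite-level reciprocity from the class field axiom -/

/-- **The norm residue symbols of `F` from the class field axiom.**
[cite: NeukirchANT1999, Ch. V §1, Thm. (1.3)] -/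
def localRecSystem (hcf : (localWeilDatum F).IsClassFieldTheory) (L : IntermediateField F (AlgebraicClosure F)) :
    Fˣ →* (L ≃ₐ[F] L) :=
  recSystem (isLocalDatum_localWeilDatum F) hcf L

/-- **`exists_isReciprocitySystem F` from the class field axiom for the local Weil datum**:
Neukirch's general reciprocity law (IV (6.3)) for the datum `localWeilDatum F` under the class field
axiom (IV (6.1) = V (1.1)) yields the finite-level reciprocity system of `F` with all the printed
properties of Serre's norm residue symbols (`LocalReciprocityFinite.lean`).
[cite: NeukirchANT1999, Ch. V §1, Thm. (1.3); Ch. IV §6, Thm. (6.3)] -/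
theorem exists_isReciprocitySystem_of_isClassFieldTheory (hcf : (localWeilDatum F).IsClassFieldTheory) :
    _root_.Literature.NumberTheory.GaloisRepresentations.exists_isReciprocitySystem F :=
  exists_isReciprocitySystem (isLocalDatum_localWeilDatum F) hcf

end Local

end LocalWeilDatum

end Literature.NumberTheory.GaloisRepresentations
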